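import Literature.Topology.Immersions.OpenParallelizableImmersionAssembly
import Literature.Topology.Immersions.OpenParallelizableImmersionChart
import Literature.Topology.FourManifolds.SublevelPushDown
import Literature.Topology.FourManifolds.Morse
import Literature.Topology.FourManifolds.PlanarArch
import Mathlib.MeasureTheory.Integral.IntervalIntegral.FundThmCalculus
import Mathlib.Analysis.Calculus.ContDiff.Deriv
import HarnessLib

/-!
# Submersions of open parallelizable manifolds: compression data from Morse theory

Topic `Literature/Topology/Immersions`; the Morse-theoretic input of the assembly theorem
`Phillips1967_exists_isLocalDiffeomorph_of_isParallelizable_of_compressibleExhaustion`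
(`OpenParallelizableImmersionAssembly.lean`): the compression data (`IsCompressionDatum`) of the
stages of the exhaustion of an open manifold by the sublevel sets of a proper Morse function.

* `exists_isCompressionDatum_of_regular` — **a stage without critical values** (Milnor 1963,
  Thm. 3.1; Phillips 1967, Lemma 2.1, the collarlike case): if the slab `f⁻¹[a - 2δ, b + 2δ]` is
  compact and free of critical points, then for `K ⊆ {f ≤ a - 2δ}`, `K' ⊆ {f < b}` and every
  `V ⊇ {f ≤ a - δ}` the diffeomorphism of the tree's `exists_diffeomorph_pushDown` (time-one map of a compactly
  supported field `-φ(f) ξ`, `ξ(f) = 1` on the slab), as a family constant in the parameter, is a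
  compression datum `IsCompressionDatum n Φ 1 {f < b} K K' V` (the transport step does not need
  `Φ₀ = id`).
* `exists_isCompressionDatum_of_critical` — **a stage with one critical point** `p` at level `c`,
  read in a Morse chart `e` (`e p = 0`, `f ∘ e⁻¹ = c - |y'|² + |y''|²` on `e.target ⊇ B̄(0, R)`,
  `y' = (y₀, …, y_{k-1})`): for every open `V` containing `{f ≤ c - ε'}` and the descending disc
  `e⁻¹{y'' = 0, |y'|² ≤ ε'}` (`ε'` small in terms of `R`, no other critical point with value in
  `[c - ε' - θ, c + εu + θ]`, this slab compact) there is a compression datum carrying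
  `K' ⊆ {f ≤ c + εu}` into `V` and fixing `K ⊆ {f ≤ c - ε' - θ}`. This is Milnor's proof of
  Thm. 3.2 (*Morse theory*, pp. 14–17) with two changes: the auxiliary function is
  `F = f - Σᵢ μ(|y'|² + Aᵢ|y''|²)` (one term per critical point) with LARGE anisotropies `Aᵢ` (Milnor: `A = 2`), which makes the
  "handle" `{F ≤ c - ε'} ∖ {f ≤ c - ε'}` as thin as we please around the descending disc, so that
  it fits into the prescribed `V`; and instead of Milnor's final deformation retraction we only
  push `{F ≤ c + εu}` down to `{F ≤ c - ε'}` along `F` (`exists_diffeomorph_pushDown`; `F⁻¹[c - ε' - δ,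
  c + εu + 3δ]` is compact without critical points: `dF = -(1 + μ')d|y'|² + (1 - Aμ')d|y''|²` with
  `-1/2 ≤ μ' ≤ 0`). The bump `μ` is the primitive of a plateau (`exists_milnorBump`), which gives
  the derivative bounds for free.

## References

* J. Milnor, *Morse theory* (1963), Thm. 3.1, Thm. 3.2 and their proofs (pp. 12–17).
  [Milnor1963]
* A. Phillips, *Submersions of open manifolds*, Topology **6** (1967), Lemma 2.1, §6.
  [Phillips1967]
-/

open scoped Manifold ContDiff Topology
open Set Function Filter Metric

noncomputable section

namespace Literature.Topology.Immersions

open Literature.Topology.FourManifolds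

/-- Local notation: `𝔼 n` is the model Euclidean space `EuclideanSpace ℝ (Fin n)`. -/
local notation "𝔼 " n:arg => EuclideanSpace ℝ (Fin n)

/-! ### Regular stages -/

section Regular

variable {n : ℕ} {M : Type*} [TopologicalSpace M] [ChartedSpace (𝔼 n) M]
  [IsManifold (𝓡 n) ∞ M] [T2Space M] [SigmaCompactSpace M]

/-- **Compression datum of a regular stage** (Milnor 1963, Thm. 3.1; Phillips 1967, Lemma 2.1):
if `f⁻¹[a - 2δ, b + 2δ]` is compact without critical points, `K ⊆ {f ≤ a - 2δ}`, `K' ⊆ {f < b}`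
and `{f ≤ a - δ} ⊆ V`, the push-down diffeomorphism is a compression datum `IsCompressionDatum n Φ τ W K K' V`
(with `τ = 1`, `W = {f < b}`, `Φ` constant in the parameter). [cite: Milnor1963, Thm. 3.1 (proof)] -/
theorem exists_isCompressionDatum_of_regular {f : M → ℝ} (hf : ContMDiff (𝓡 n) 𝓘(ℝ, ℝ) ∞ f)
    {a b δ : ℝ} (hab : a ≤ b) (hδ : 0 < δ)
    (hcpt : IsCompact (f ⁻¹' Icc (a - 2 * δ) (b + 2 * δ)))
    (hreg : ∀ x, f x ∈ Icc (a - 2 * δ) (b + 2 * δ) → ¬ IsMCriticalPt (𝓡 n) f x)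
    {K K' V : Set M} (hK : ∀ x ∈ K, f x ≤ a - 2 * δ) (hK' : ∀ x ∈ K', f x < b)
    (hV : ∀ x, f x ≤ a - δ → x ∈ V) :
    ∃ (Φ : ℝ × M → M) (τ : M → ℝ) (W : Set M), IsCompressionDatum n Φ τ W K K' V := by
  obtain ⟨Φ₁, -, hdown, hfix, -⟩ := exists_diffeomorph_pushDown hf hab hδ hcpt hreg
  refine ⟨fun q => Φ₁ q.2, fun _ => 1, {x | f x < b}, ?_⟩
  exact
    { contMDiff := Φ₁.contMDiff.comp contMDiff_snd
      isInvertible := fun s _ x =>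
        ⟨Φ₁.mfderivToContinuousLinearEquiv (by simp) x, Φ₁.mfderivToContinuousLinearEquiv_coe _⟩
      contMDiff_cutoff := contMDiff_const
      cutoff_mem := fun _ => ⟨zero_le_one, le_rfl⟩
      isOpen := isOpen_lt hf.continuous continuous_const
      subset := fun x hx => hK' x hx
      cutoff_eq_one := fun _ _ => rfl
      maps_into := fun x hx => hV _ (hdown x (le_of_lt hx))
      fixes := fun x hx s => hfix x (hK x hx) }

end Regular

/-! ### The quadratic forms of a Morse chart -/

section Quadratic

variable {m : ℕ}

/-- `|y'|² = Σ_{i < k} yᵢ²`, the negative part of the Morse normal form. [cite: Milnor1963, Lemma 2.2] -/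
def lowSq (k : ℕ) (y : 𝔼 m) : ℝ := ∑ i ∈ Finset.univ.filter (fun i : Fin m => i.val < k), (y i) ^ 2

/-- `|y''|² = Σ_{i ≥ k} yᵢ²`, the positive part of the Morse normal form. [cite: Milnor1963, Lemma 2.2] -/
def highSq (k : ℕ) (y : 𝔼 m) : ℝ := ∑ i ∈ Finset.univ.filter (fun i : Fin m => k ≤ i.val), (y i) ^ 2

/-- `lowSq` is nonnegative. [folklore] -/
theorem lowSq_nonneg (k : ℕ) (y : 𝔼 m) : 0 ≤ lowSq k y :=
  Finset.sum_nonneg fun i _ => sq_nonneg (y i)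

/-- `highSq` is nonnegative. [folklore] -/
theorem highSq_nonneg (k : ℕ) (y : 𝔼 m) : 0 ≤ highSq k y :=
  Finset.sum_nonneg fun i _ => sq_nonneg (y i)

/-- `|y'|² + |y''|² = ‖y‖²`. [folklore] -/
theorem lowSq_add_highSq (k : ℕ) (y : 𝔼 m) : lowSq k y + highSq k y = ‖y‖ ^ 2 := by
  rw [EuclideanSpace.norm_sq_eq, lowSq, highSq]
  have h := Finset.sum_filter_add_sum_filter_not Finset.univ (fun i : Fin m => i.val < k)
    (fun i => (y i) ^ 2)
  simp only [not_lt] at h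
  rw [h]
  exact Finset.sum_congr rfl fun i _ => by rw [Real.norm_eq_abs, sq_abs]

/-- A coordinate square bounded by `lowSq`. [folklore] -/
theorem sq_le_lowSq {k : ℕ} (y : 𝔼 m) {i : Fin m} (hi : i.val < k) : (y i) ^ 2 ≤ lowSq k y :=
  Finset.single_le_sum (f := fun j => (y j) ^ 2) (fun j _ => sq_nonneg (y j))
    (Finset.mem_filter.2 ⟨Finset.mem_univ _, hi⟩)

/-- A coordinate square bounded by `highSq`. [folklore] -/
theorem sq_le_highSq {k : ℕ} (y : 𝔼 m) {i : Fin m} (hi : k ≤ i.val) : (y i) ^ 2 ≤ highSq k y :=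
  Finset.single_le_sum (f := fun j => (y j) ^ 2) (fun j _ => sq_nonneg (y j))
    (Finset.mem_filter.2 ⟨Finset.mem_univ _, hi⟩)

/-- Derivative of a coordinate square. [folklore] -/
theorem hasFDerivAt_sq_apply (i : Fin m) (y : 𝔼 m) :
    HasFDerivAt (fun z : 𝔼 m => (z i) ^ 2) ((2 * y i) • (EuclideanSpace.proj i : 𝔼 m →L[ℝ] ℝ)) y := by
  set p : 𝔼 m →L[ℝ] ℝ := EuclideanSpace.proj (𝕜 := ℝ) i with hp
  have hpa : ∀ z : 𝔼 m, p z = z i := fun z => rfl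
  have h := p.hasFDerivAt (x := y)
  have h2 : HasFDerivAt (fun z : 𝔼 m => p z * p z) (p y • p + p y • p) y := h.mul h
  have heq : (fun z : 𝔼 m => (z i) ^ 2) = fun z => p z * p z := by
    funext z; rw [hpa, sq]
  rw [heq]
  refine h2.congr_fderiv ?_
  rw [← add_smul, hpa, two_mul]

/-- Derivative of `lowSq`. [folklore] -/
theorem hasFDerivAt_lowSq (k : ℕ) (y : 𝔼 m) :
    HasFDerivAt (lowSq (m := m) k)
      (∑ i ∈ Finset.univ.filter (fun i : Fin m => i.val < k),
        (2 * y i) • (EuclideanSpace.proj i : 𝔼 m →L[ℝ] ℝ)) y := by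
  have : lowSq (m := m) k = fun z => ∑ i ∈ Finset.univ.filter (fun i : Fin m => i.val < k), (z i) ^ 2 := rfl
  rw [this]
  exact HasFDerivAt.fun_sum fun i _ => hasFDerivAt_sq_apply i y

/-- Derivative of `highSq`. [folklore] -/
theorem hasFDerivAt_highSq (k : ℕ) (y : 𝔼 m) :
    HasFDerivAt (highSq (m := m) k)
      (∑ i ∈ Finset.univ.filter (fun i : Fin m => k ≤ i.val),
        (2 * y i) • (EuclideanSpace.proj i : 𝔼 m →L[ℝ] ℝ)) y := by
  have : highSq (m := m) k = fun z => ∑ i ∈ Finset.univ.filter (fun i : Fin m => k ≤ i.val), (z i) ^ 2 := rfl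
  rw [this]
  exact HasFDerivAt.fun_sum fun i _ => hasFDerivAt_sq_apply i y

/-- `lowSq` is `C^∞`. [folklore] -/
theorem contDiff_lowSq (k : ℕ) : ContDiff ℝ ∞ (lowSq (m := m) k) := by
  unfold lowSq
  exact ContDiff.sum fun i _ => ((EuclideanSpace.proj (𝕜 := ℝ) i : 𝔼 m →L[ℝ] ℝ).contDiff).pow 2

/-- `highSq` is `C^∞`. [folklore] -/
theorem contDiff_highSq (k : ℕ) : ContDiff ℝ ∞ (highSq (m := m) k) := by
  unfold highSq
  exact ContDiff.sum fun i _ => ((EuclideanSpace.proj (𝕜 := ℝ) i : 𝔼 m →L[ℝ] ℝ).contDiff).pow 2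

/-- Value of `d(lowSq)` on a basis vector. [folklore] -/
theorem fderiv_lowSq_single (k : ℕ) (y : 𝔼 m) (j : Fin m) :
    fderiv ℝ (lowSq (m := m) k) y (EuclideanSpace.single j 1) = if j.val < k then 2 * y j else 0 := by
  rw [(hasFDerivAt_lowSq k y).fderiv, FunLike.coe_sum, Finset.sum_apply]
  have h : ∀ i : Fin m, ((2 * y i) • (EuclideanSpace.proj i : 𝔼 m →L[ℝ] ℝ)) (EuclideanSpace.single j 1)
      = if j = i then 2 * y i else 0 := fun i => by
    show (2 * y i) * (EuclideanSpace.single j (1 : ℝ)) i = _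
    rw [PiLp.single_apply]
    split_ifs with h1 h2 h2
    · ring
    · exact absurd h1.symm h2
    · exact absurd h2.symm h1
    · ring
  simp_rw [h]
  rw [Finset.sum_ite_eq]
  simp

/-- Value of `d(highSq)` on a basis vector. [folklore] -/
theorem fderiv_highSq_single (k : ℕ) (y : 𝔼 m) (j : Fin m) :
    fderiv ℝ (highSq (m := m) k) y (EuclideanSpace.single j 1) = if k ≤ j.val then 2 * y j else 0 := by
  rw [(hasFDerivAt_highSq k y).fderiv, FunLike.coe_sum, Finset.sum_apply]
  have h : ∀ i : Fin m, ((2 * y i) • (EuclideanSpace.proj i : 𝔼 m →L[ℝ] ℝ)) (EuclideanSpace.single j 1)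
      = if j = i then 2 * y i else 0 := fun i => by
    show (2 * y i) * (EuclideanSpace.single j (1 : ℝ)) i = _
    rw [PiLp.single_apply]
    split_ifs with h1 h2 h2
    · ring
    · exact absurd h1.symm h2
    · exact absurd h2.symm h1
    · ring
  simp_rw [h]
  rw [Finset.sum_ite_eq]
  simp

end Quadratic

/-! ### Milnor's bump with controlled slope -/

/-- **A bump with slope in `[-1/2, 0]`**: for `L > 0` there is a `C^∞` function `μ ≥ 0` with
`μ = μ 0 ≥ 3L/8` on `(-∞, 0]`, `μ = 0` on `[L, ∞)` and `-1/2 ≤ μ' ≤ 0` (the primitive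
`μ(r) = ∫ᵣᴸ σ` of a plateau `σ` with values in `[0, 1/2]`, `= 1/2` on `[L/8, 7L/8]`). Milnor
(1963, p. 15) asks for `μ(0) > ε`, `μ = 0` on `[2ε, ∞)`, `-1 < μ' ≤ 0`. [cite: Milnor1963, Thm. 3.2 (proof)] -/
theorem exists_milnorBump {L : ℝ} (hL : 0 < L) :
    ∃ μ : ℝ → ℝ, ContDiff ℝ ∞ μ ∧ (∀ r, 0 ≤ μ r) ∧ (∀ r ≤ 0, μ r = μ 0) ∧ 3 * L / 8 ≤ μ 0 ∧
      (∀ r, L ≤ r → μ r = 0) ∧ (∀ r, deriv μ r ≤ 0) ∧ ∀ r, -(1 / 2 : ℝ) ≤ deriv μ r := by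
  -- the plateau `σ`
  have h8 : (0 : ℝ) < L / 8 := by positivity
  have h78 : 7 * L / 8 < L := by linarith
  set σ : ℝ → ℝ := fun t => (1 / 2) * (smoothStep 0 (L / 8) t * (1 - smoothStep (7 * L / 8) L t))
    with hσ
  have hσs : ContDiff ℝ ∞ σ :=
    contDiff_const.mul ((contDiff_smoothStep _ _).mul (contDiff_const.sub (contDiff_smoothStep _ _)))
  have hσc : Continuous σ := hσs.continuous
  have hσ0 : ∀ t, 0 ≤ σ t := fun t => by
    have h1 := (smoothStep_mem_Icc 0 (L / 8) t)
    have h2 := (smoothStep_mem_Icc (7 * L / 8) L t)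
    simp only [hσ]
    exact mul_nonneg (by norm_num) (mul_nonneg h1.1 (by linarith [h2.2]))
  have hσle : ∀ t, σ t ≤ 1 / 2 := fun t => by
    have h1 := (smoothStep_mem_Icc 0 (L / 8) t)
    have h2 := (smoothStep_mem_Icc (7 * L / 8) L t)
    simp only [hσ]
    have : smoothStep 0 (L / 8) t * (1 - smoothStep (7 * L / 8) L t) ≤ 1 := by
      calc _ ≤ 1 * 1 := mul_le_mul h1.2 (by linarith [h2.1]) (by linarith [h2.2]) zero_le_one
        _ = 1 := one_mul _
    linarith
  have hσneg : ∀ t ≤ 0, σ t = 0 := fun t ht => by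
    simp [hσ, smoothStep_of_le h8 ht]
  have hσL : ∀ t, L ≤ t → σ t = 0 := fun t ht => by
    simp [hσ, smoothStep_of_ge h78 ht]
  have hσmid : ∀ t ∈ Icc (L / 8) (7 * L / 8), σ t = 1 / 2 := fun t ht => by
    simp [hσ, smoothStep_of_ge h8 ht.1, smoothStep_of_le h78 ht.2]
  have hint : ∀ a b, IntervalIntegrable σ MeasureTheory.volume a b := fun a b =>
    hσc.intervalIntegrable a b
  -- the primitive
  set P : ℝ → ℝ := fun r => ∫ t in (0 : ℝ)..r, σ t with hP
  have hPd : ∀ r, HasDerivAt P (σ r) r := fun r =>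
    intervalIntegral.integral_hasDerivAt_right (hint 0 r) hσc.aestronglyMeasurable.stronglyMeasurableAtFilter
      hσc.continuousAt
  have hPderiv : deriv P = σ := funext fun r => (hPd r).deriv
  have hPdiff : Differentiable ℝ P := fun r => (hPd r).differentiableAt
  have hPs : ContDiff ℝ ∞ P := contDiff_infty_iff_deriv.2 ⟨hPdiff, by rw [hPderiv]; exact hσs⟩
  set μ : ℝ → ℝ := fun r => P L - P r with hμ
  have hμd : ∀ r, HasDerivAt μ (-σ r) r := fun r => by
    simpa using (hPd r).const_sub (P L)
  have hμderiv : ∀ r, deriv μ r = -σ r := fun r => (hμd r).deriv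
  -- monotonicity of the primitive
  have hPmono : Monotone P := by
    intro r s hrs
    simp only [hP]
    rw [← intervalIntegral.integral_add_adjacent_intervals (hint 0 r) (hint r s)]
    have h0 : 0 ≤ ∫ u in r..s, σ u := intervalIntegral.integral_nonneg_of_forall hrs fun u => hσ0 u
    linarith
  have hPconst_neg : ∀ r ≤ 0, P r = 0 := fun r hr => by
    simp only [hP]
    rw [intervalIntegral.integral_symm, intervalIntegral.integral_congr (g := fun _ => (0 : ℝ)), 
      intervalIntegral.integral_zero, neg_zero]
    intro t ht
    rw [uIcc_of_le hr] at ht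
    exact hσneg t ht.2
  have hPconst_L : ∀ r, L ≤ r → P r = P L := fun r hr => by
    simp only [hP]
    have hadd := intervalIntegral.integral_add_adjacent_intervals (hint 0 L) (hint L r)
    have hz : ∫ t in L..r, σ t = 0 := by
      rw [intervalIntegral.integral_congr (g := fun _ => (0 : ℝ)) (fun t ht => ?_),
        intervalIntegral.integral_zero]
      rw [uIcc_of_le hr] at ht
      exact hσL t ht.1
    linarith
  have hP0 : P 0 = 0 := hPconst_neg 0 le_rfl
  -- the lower bound `P L ≥ 3L/8`
  have hPL : 3 * L / 8 ≤ P L := by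
    have hsplit : P L = (∫ t in (0 : ℝ)..(L / 8), σ t) + ((∫ t in (L / 8)..(7 * L / 8), σ t) +
        ∫ t in (7 * L / 8)..L, σ t) := by
      simp only [hP]
      rw [intervalIntegral.integral_add_adjacent_intervals (hint _ _) (hint _ _),
        intervalIntegral.integral_add_adjacent_intervals (hint _ _) (hint _ _)]
    have h1 : 0 ≤ ∫ t in (0 : ℝ)..(L / 8), σ t :=
      intervalIntegral.integral_nonneg_of_forall h8.le fun u => hσ0 u
    have h3 : 0 ≤ ∫ t in (7 * L / 8)..L, σ t :=
      intervalIntegral.integral_nonneg_of_forall h78.le fun u => hσ0 u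
    have h2 : ∫ t in (L / 8)..(7 * L / 8), σ t = 3 * L / 8 := by
      rw [intervalIntegral.integral_congr (g := fun _ => (1 / 2 : ℝ)) (fun t ht => ?_),
        intervalIntegral.integral_const, smul_eq_mul]
      · ring
      · rw [uIcc_of_le (by linarith)] at ht
        exact hσmid t ht
    linarith
  refine ⟨μ, contDiff_const.sub hPs, fun r => ?_, fun r hr => ?_, ?_, fun r hr => ?_,
    fun r => ?_, fun r => ?_⟩
  · -- `0 ≤ μ r`
    simp only [hμ]
    rcases le_total r L with h | h
    · linarith [hPmono h]
    · rw [hPconst_L r h]; simp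
  · simp only [hμ, hPconst_neg r hr, hP0]
  · simp only [hμ, hP0, sub_zero]; exact hPL
  · simp only [hμ, hPconst_L r hr, sub_self]
  · rw [hμderiv]; linarith [hσ0 r]
  · rw [hμderiv]; linarith [hσle r]


/-! ### Critical points read in a chart of the maximal atlas -/

section ChartCritical

variable {m : ℕ} {M : Type*} [TopologicalSpace M] [ChartedSpace (𝔼 m) M]

/-- **Criticality is read in any compatible chart**: if `F ∘ e⁻¹ = G` on `e.target` for a chart `e`
of the maximal `C^∞` atlas and `G` is differentiable at `e x`, `x ∈ e.source`, then `x` is a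
critical point of `F` iff `dG_{e x} = 0`. [folklore] -/
theorem isMCriticalPt_iff_fderiv_eq_zero {e : OpenPartialHomeomorph M (𝔼 m)}
    (he : e ∈ IsManifold.maximalAtlas (𝓡 m) ∞ M) {F : M → ℝ} {G : 𝔼 m → ℝ} {x : M}
    (hx : x ∈ e.source) (hFG : ∀ y ∈ e.target, F (e.symm y) = G y)
    (hG : DifferentiableAt ℝ G (e x)) :
    IsMCriticalPt (𝓡 m) F x ↔ fderiv ℝ G (e x) = 0 := by
  -- `F = G ∘ e` near `x`
  have hev : F =ᶠ[𝓝 x] fun z => G (e z) := by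
    filter_upwards [e.open_source.mem_nhds hx] with z hz
    rw [← hFG (e z) (e.map_source hz), e.left_inv hz]
  have hmf : mfderiv (𝓡 m) 𝓘(ℝ, ℝ) F x = mfderiv (𝓡 m) 𝓘(ℝ, ℝ) (fun z => G (e z)) x :=
    hev.mfderiv_eq
  have hed : MDifferentiableAt (𝓡 m) (𝓡 m) e x :=
    ((contMDiffOn_of_mem_maximalAtlas he).mdifferentiableOn (by simp) x hx).mdifferentiableAt
      (e.open_source.mem_nhds hx)
  have hGd : MDifferentiableAt (𝓡 m) 𝓘(ℝ, ℝ) G (e x) := hG.mdifferentiableAt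
  have hcomp : mfderiv (𝓡 m) 𝓘(ℝ, ℝ) (fun z => G (e z)) x =
      (mfderiv 𝓘(ℝ, 𝔼 m) 𝓘(ℝ, ℝ) G (e x)).comp (mfderiv (𝓡 m) (𝓡 m) e x) :=
    mfderiv_comp x hGd hed
  set L := (mdifferentiable_of_mem_maximalAtlas' he).mfderiv hx with hL
  have hLe : (L : TangentSpace (𝓡 m) x →L[ℝ] TangentSpace (𝓡 m) (e x)) =
      mfderiv (𝓡 m) (𝓡 m) e x := rfl
  have key : mfderiv (𝓡 m) 𝓘(ℝ, ℝ) (fun z => G (e z)) x = 0 ↔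
      mfderiv 𝓘(ℝ, 𝔼 m) 𝓘(ℝ, ℝ) G (e x) = 0 := by
    rw [hcomp, ← hLe]
    constructor
    · intro h
      ext v
      have h1 := DFunLike.congr_fun h (L.symm v)
      rw [ContinuousLinearMap.comp_apply, ContinuousLinearEquiv.coe_coe,
        L.apply_symm_apply] at h1
      exact h1
    · intro h
      rw [h]
      ext v
      rfl
  have e1 : IsMCriticalPt (𝓡 m) F x ↔ mfderiv (𝓡 m) 𝓘(ℝ, ℝ) (fun z => G (e z)) x = 0 :=
    (congrArg (· = 0) hmf).to_iff
  have e2 : mfderiv 𝓘(ℝ, 𝔼 m) 𝓘(ℝ, ℝ) G (e x) = 0 ↔ fderiv ℝ G (e x) = 0 :=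
    (congrArg (· = 0) (mfderiv_eq_fderiv (f := G) (x := e x))).to_iff
  exact e1.trans (key.trans e2)

end ChartCritical


/-! ### Critical stages: Milnor's modified function and the compression -/

section Critical

variable {m : ℕ}

/-- The point of the plane `y'' = 0` below `y`: the coordinates of index `≥ k` set to `0`. [folklore] -/
def lowPart (k : ℕ) (y : 𝔼 m) : 𝔼 m := WithLp.toLp 2 fun i => if i.val < k then y i else 0

/-- Coordinates of `lowPart`. [folklore] -/
@[simp] theorem lowPart_apply (k : ℕ) (y : 𝔼 m) (i : Fin m) :
    lowPart k y i = if i.val < k then y i else 0 := rfl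

/-- `lowPart` lies in the plane `y'' = 0`. [folklore] -/
theorem highSq_lowPart (k : ℕ) (y : 𝔼 m) : highSq k (lowPart k y) = 0 := by
  unfold highSq
  refine Finset.sum_eq_zero fun i hi => ?_
  have hi' : k ≤ i.val := (Finset.mem_filter.1 hi).2
  simp [lowPart_apply, not_lt.2 hi']

/-- `lowPart` has the same `|y'|²`. [folklore] -/
theorem lowSq_lowPart (k : ℕ) (y : 𝔼 m) : lowSq k (lowPart k y) = lowSq k y := by
  unfold lowSq
  refine Finset.sum_congr rfl fun i hi => ?_
  have hi' : i.val < k := (Finset.mem_filter.1 hi).2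
  simp [lowPart_apply, hi']

/-- The distance from `y` to `lowPart k y` is `|y''|`. [folklore] -/
theorem norm_sub_lowPart_sq (k : ℕ) (y : 𝔼 m) : ‖y - lowPart k y‖ ^ 2 = highSq k y := by
  rw [EuclideanSpace.norm_sq_eq, highSq]
  rw [← Finset.sum_filter_add_sum_filter_not Finset.univ (fun i : Fin m => k ≤ i.val)]
  have h2 : ∑ i ∈ Finset.univ.filter (fun i : Fin m => ¬ k ≤ i.val), ‖(y - lowPart k y) i‖ ^ 2 = 0 := by
    refine Finset.sum_eq_zero fun i hi => ?_
    have hi' : i.val < k := not_le.1 (Finset.mem_filter.1 hi).2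
    simp [lowPart_apply, hi']
  rw [h2, add_zero]
  refine Finset.sum_congr rfl fun i hi => ?_
  have hi' : k ≤ i.val := (Finset.mem_filter.1 hi).2
  simp [lowPart_apply, not_lt.2 hi', Real.norm_eq_abs, sq_abs]

/-- `‖y‖² ≤ |y'|² + A|y''|²` for `A ≥ 1`. [folklore] -/
theorem norm_sq_le_lowSq_add_mul_highSq (k : ℕ) (y : 𝔼 m) {A : ℝ} (hA : 1 ≤ A) :
    ‖y‖ ^ 2 ≤ lowSq k y + A * highSq k y := by
  rw [← lowSq_add_highSq k y]
  nlinarith [highSq_nonneg k y]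

variable {M : Type*} [TopologicalSpace M] [ChartedSpace (𝔼 m) M]
  [IsManifold (𝓡 m) ∞ M] [T2Space M] [SigmaCompactSpace M]

open Classical in
/-- **Compression datum of a critical stage** (Milnor 1963, Thm. 3.2 and Remark 3.3, proof, with
an anisotropic auxiliary function; Phillips 1967, §6). Let `f` be `C^∞` on `M` and `e i`
(`i : ι`, finitely many) charts of the maximal atlas with pairwise disjoint sources,
`B̄(0, R) ⊆ (e i).target` and `f ∘ (e i)⁻¹ = c - |y'|² + |y''|²` on `(e i).target`
(`y' = (y_j)_{j < k i}`), `0 < 20ε' < R²`, and suppose the slab `f⁻¹[c - ε' - θ, c + εu + θ]` is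
compact and its critical points are among the centres `(e i)⁻¹ 0`. Then for
`K ⊆ {f ≤ c - ε' - θ}`, `K' ⊆ {f ≤ c + εu}` and every open `V` containing `{f ≤ c - ε'}` and the
descending discs `(e i)⁻¹{y'' = 0, |y'|² ≤ ε'}` there is a compression datum
`IsCompressionDatum m Φ τ W K K' V`: the push-down diffeomorphism of `F = f - Σᵢ μ(|y'|² + Aᵢ|y''|²)` from
`{F ≤ c + εu + δ}` to `{F ≤ c - ε'} ⊆ V`. [cite: Milnor1963, Thm. 3.2 (proof)] -/
theorem exists_isCompressionDatum_of_critical {ι : Type*} [Fintype ι]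
    {f : M → ℝ} (hf : ContMDiff (𝓡 m) 𝓘(ℝ, ℝ) ∞ f) {c : ℝ} {k : ι → ℕ}
    {e : ι → OpenPartialHomeomorph M (𝔼 m)} (he : ∀ i, e i ∈ IsManifold.maximalAtlas (𝓡 m) ∞ M)
    (hdisj : Pairwise fun i j => Disjoint (e i).source (e j).source) {R : ℝ} (hR : 0 < R)
    (hRe : ∀ i, closedBall (0 : 𝔼 m) R ⊆ (e i).target)
    (hfe : ∀ i, ∀ y ∈ (e i).target, f ((e i).symm y) = c - lowSq (k i) y + highSq (k i) y)
    {ε' εu θ : ℝ} (hε' : 0 < ε') (hε'R : 20 * ε' < R ^ 2) (hεu : 0 < εu) (hθ : 0 < θ)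
    (hcpt : IsCompact (f ⁻¹' Icc (c - ε' - θ) (c + εu + θ)))
    (hcrit : ∀ x, f x ∈ Icc (c - ε' - θ) (c + εu + θ) → IsMCriticalPt (𝓡 m) f x →
      ∃ i, x = (e i).symm 0)
    {K K' V : Set M} (hK : ∀ x ∈ K, f x ≤ c - ε' - θ) (hK' : ∀ x ∈ K', f x ≤ c + εu)
    (hV : IsOpen V) (hV₁ : ∀ x, f x ≤ c - ε' → x ∈ V)
    (hV₂ : ∀ i, ∀ y ∈ (e i).target, highSq (k i) y = 0 → lowSq (k i) y ≤ ε' → (e i).symm y ∈ V) :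
    ∃ (Φ : ℝ × M → M) (τ : M → ℝ) (W : Set M), IsCompressionDatum m Φ τ W K K' V := by
  classical
  -- (V1) a margin `s₀` above the level `c - ε'` inside `V`
  obtain ⟨s₀, hs₀, hVs₀⟩ : ∃ s₀ > 0, ∀ x, f x < c - ε' + s₀ → x ∈ V := by
    set S : Set M := f ⁻¹' Icc (c - ε') (c - ε' + θ) ∩ Vᶜ with hS
    have hSc : IsCompact S := by
      refine (hcpt.of_isClosed_subset ((isClosed_Icc.preimage hf.continuous).inter hV.isClosed_compl) ?_)
      rintro x ⟨hx, -⟩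
      exact ⟨by linarith [hx.1], by linarith [hx.2]⟩
    rcases S.eq_empty_or_nonempty with hSe | hSne
    · refine ⟨θ, hθ, fun x hx => ?_⟩
      by_contra hxV
      rcases le_or_gt (f x) (c - ε') with h | h
      · exact hxV (hV₁ x h)
      · have : x ∈ S := ⟨⟨h.le, hx.le⟩, hxV⟩
        rw [hSe] at this
        exact this
    · obtain ⟨z, hzS, hzmin⟩ := hSc.exists_isMinOn hSne hf.continuous.continuousOn
      have hzgt : c - ε' < f z := by
        by_contra h
        exact hzS.2 (hV₁ z (not_lt.1 h))
      refine ⟨min θ (f z - (c - ε')), lt_min hθ (by linarith), fun x hx => ?_⟩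
      by_contra hxV
      rcases le_or_gt (f x) (c - ε') with h | h
      · exact hxV (hV₁ x h)
      · have hxS : x ∈ S := ⟨⟨h.le, by linarith [min_le_left θ (f z - (c - ε'))]⟩, hxV⟩
        have := hzmin hxS
        simp only [mem_setOf_eq] at this
        linarith [min_le_right θ (f z - (c - ε'))]
  -- (V2) margins `s₁ i` around the descending discs inside `V`
  set T₀ : ι → Set (𝔼 m) := fun i => {y | highSq (k i) y = 0 ∧ lowSq (k i) y ≤ ε'} with hT₀
  have hT₀ball : ∀ i, T₀ i ⊆ closedBall (0 : 𝔼 m) (R / 2) := by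
    intro i y hy
    rw [mem_closedBall, dist_zero_right]
    have h1 : ‖y‖ ^ 2 ≤ ε' := by rw [← lowSq_add_highSq (k i) y, hy.1, add_zero]; exact hy.2
    nlinarith [norm_nonneg y, sq_nonneg (R / 2)]
  have hT₀c : ∀ i, IsCompact (T₀ i) := fun i => by
    refine (isCompact_closedBall (0 : 𝔼 m) (R / 2)).of_isClosed_subset ?_ (hT₀ball i)
    exact (isClosed_eq (contDiff_highSq (k i)).continuous continuous_const).inter
      (isClosed_le (contDiff_lowSq (k i)).continuous continuous_const)
  set O : ι → Set (𝔼 m) := fun i => (e i).target ∩ (e i).symm ⁻¹' V with hO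
  have hOopen : ∀ i, IsOpen (O i) := fun i => (e i).symm.isOpen_inter_preimage hV
  have hT₀O : ∀ i, T₀ i ⊆ O i := fun i y hy => by
    have hyt : y ∈ (e i).target := hRe i ((closedBall_subset_closedBall (by linarith)) (hT₀ball i hy))
    exact ⟨hyt, hV₂ i y hyt hy.1 hy.2⟩
  have hs₁ex : ∀ i, ∃ s₁ > 0, thickening s₁ (T₀ i) ⊆ O i := fun i =>
    (hT₀c i).exists_thickening_subset_open (hOopen i) (hT₀O i)
  choose s₁ hs₁ hthick using hs₁ex
  -- constants
  set L : ℝ := 5 * ε' with hL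
  have hLpos : 0 < L := by positivity
  have hLR : L < (R / 2) ^ 2 := by rw [hL]; nlinarith
  set A : ι → ℝ := fun i => 2 + 4 * L / s₀ + 4 * L / s₁ i ^ 2 with hA
  have hA2 : ∀ i, 2 ≤ A i := fun i => by
    have : 0 ≤ 4 * L / s₀ := by positivity
    have : 0 ≤ 4 * L / s₁ i ^ 2 := by have := hs₁ i; positivity
    simp only [hA]; linarith
  have hA1 : ∀ i, 1 ≤ A i := fun i => by linarith [hA2 i]
  have hApos : ∀ i, 0 < A i := fun i => by linarith [hA2 i]
  have hLA₀ : ∀ i, L / A i ≤ s₀ / 4 := fun i => by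
    rw [div_le_iff₀ (hApos i)]
    have : L = s₀ / 4 * (4 * L / s₀) := by field_simp
    have hs := hs₁ i
    nlinarith [this, show 0 ≤ s₀ / 4 * (2 + 4 * L / s₁ i ^ 2) by positivity]
  have hLA₁ : ∀ i, L / A i ≤ s₁ i ^ 2 / 4 := fun i => by
    rw [div_le_iff₀ (hApos i)]
    have hs := hs₁ i
    have : L = s₁ i ^ 2 / 4 * (4 * L / s₁ i ^ 2) := by field_simp
    nlinarith [this, show 0 ≤ s₁ i ^ 2 / 4 * (2 + 4 * L / s₀) by positivity]
  set δF : ℝ := min (θ / 4) (ε' / 4) with hδF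
  have hδF : 0 < δF := lt_min (by positivity) (by positivity)
  have hδFθ : δF ≤ θ / 4 := min_le_left _ _
  have hδFε : δF ≤ ε' / 4 := min_le_right _ _
  -- Milnor's bump and the auxiliary function
  obtain ⟨μ, hμs, hμ0, hμneg, hμ0ge, hμL, hμ'le, hμ'ge⟩ := exists_milnorBump hLpos
  set ρf : ι → 𝔼 m → ℝ := fun i y => lowSq (k i) y + A i * highSq (k i) y with hρf
  have hρfs : ∀ i, ContDiff ℝ ∞ (ρf i) := fun i =>
    (contDiff_lowSq (k i)).add (contDiff_const.mul (contDiff_highSq (k i)))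
  have hρf_norm : ∀ i y, ‖y‖ ^ 2 ≤ ρf i y := fun i y =>
    norm_sq_le_lowSq_add_mul_highSq (k i) y (hA1 i)
  set d : ι → 𝔼 m → ℝ := fun i y => μ (ρf i y) with hd
  have hds : ∀ i, ContDiff ℝ ∞ (d i) := fun i => hμs.comp (hρfs i)
  have hd_zero : ∀ i y, L ≤ ρf i y → d i y = 0 := fun i y hy => hμL _ hy
  have hsqrtL : Real.sqrt L < R / 2 := by
    rw [Real.sqrt_lt' (by positivity)]; exact hLR
  have hd_ball : ∀ i y, d i y ≠ 0 → y ∈ ball (0 : 𝔼 m) (Real.sqrt L) := by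
    intro i y hy
    rw [mem_ball, dist_zero_right]
    have h1 : ρf i y < L := by
      by_contra h; exact hy (hd_zero i y (not_lt.1 h))
    have h2 : ‖y‖ ^ 2 < L := lt_of_le_of_lt (hρf_norm i y) h1
    exact Real.lt_sqrt_of_sq_lt h2
  have hd_supp : ∀ i, tsupport (d i) ⊆ closedBall (0 : 𝔼 m) (Real.sqrt L) := fun i =>
    closure_minimal (fun y hy => ball_subset_closedBall (hd_ball i y hy)) isClosed_closedBall
  have hballR : ∀ i, closedBall (0 : 𝔼 m) (Real.sqrt L) ⊆ (e i).target := fun i =>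
    (closedBall_subset_closedBall (by linarith)).trans (hRe i)
  set Dm : ι → M → ℝ := fun i x => if x ∈ (e i).source then d i (e i x) else 0 with hDm
  have hDms : ∀ i, ContMDiff (𝓡 m) 𝓘(ℝ, ℝ) ∞ (Dm i) := fun i =>
    contMDiff_extend_comp_chart (he i) (hds i) (isCompact_closedBall _ _) (hballR i) (hd_supp i)
  set D : M → ℝ := fun x => ∑ i, Dm i x with hD
  have hDs : ContMDiff (𝓡 m) 𝓘(ℝ, ℝ) ∞ D := by
    simp only [hD]
    exact ContMDiff.sum fun i _ => hDms i
  set F : M → ℝ := fun x => f x - D x with hF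
  have hFs : ContMDiff (𝓡 m) 𝓘(ℝ, ℝ) ∞ F := hf.sub hDs
  -- basic comparisons
  have hDm0 : ∀ i x, 0 ≤ Dm i x := fun i x => by
    simp only [hDm]; split_ifs
    · exact hμ0 _
    · exact le_rfl
  have hD0 : ∀ x, 0 ≤ D x := fun x => Finset.sum_nonneg fun i _ => hDm0 i x
  have hFle : ∀ x, F x ≤ f x := fun x => by simp only [hF]; linarith [hD0 x]
  -- where the modification vanishes, `F = f`
  set Kc : ι → Set M := fun i => (e i).symm '' closedBall (0 : 𝔼 m) (Real.sqrt L) with hKc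
  have hKc_cpt : ∀ i, IsCompact (Kc i) := fun i =>
    (isCompact_closedBall _ _).image_of_continuousOn ((e i).continuousOn_symm.mono (hballR i))
  have hKc_src : ∀ i, Kc i ⊆ (e i).source := by
    rintro i _ ⟨y, hy, rfl⟩; exact (e i).map_target (hballR i hy)
  have hDm_zero : ∀ i, ∀ x ∉ Kc i, Dm i x = 0 := by
    intro i x hx
    simp only [hDm]
    split_ifs with hxs
    · by_contra hne
      exact hx ⟨e i x, ball_subset_closedBall (hd_ball i _ hne), (e i).left_inv hxs⟩
    · rfl
  set Kall : Set M := ⋃ i, Kc i with hKall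
  have hKall_cpt : IsCompact Kall := isCompact_iUnion fun i => hKc_cpt i
  have hD_zero : ∀ x ∉ Kall, D x = 0 := fun x hx => by
    simp only [hD]
    exact Finset.sum_eq_zero fun i _ => hDm_zero i x fun h => hx (mem_iUnion.2 ⟨i, h⟩)
  have hF_eq : ∀ x ∉ Kall, F x = f x := fun x hx => by simp only [hF, hD_zero x hx, sub_zero]
  have hF_ev : ∀ x ∉ Kall, F =ᶠ[𝓝 x] f := fun x hx => by
    filter_upwards [hKall_cpt.isClosed.isOpen_compl.mem_nhds hx] with z hz
    exact hF_eq z hz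
  -- on the source of `e i` only `Dm i` contributes
  have hD_src : ∀ i, ∀ x ∈ (e i).source, D x = Dm i x := by
    intro i x hx
    simp only [hD]
    rw [Finset.sum_eq_single i (fun j _ hji => ?_) (fun h => absurd (Finset.mem_univ i) h)]
    have hxj : x ∉ (e j).source := fun h' => (hdisj hji).le_bot ⟨h', hx⟩
    simp only [hDm, hxj, if_false]
  -- the chart formula for `F`
  set G : ι → 𝔼 m → ℝ := fun i y => c - lowSq (k i) y + highSq (k i) y - μ (ρf i y) with hG
  have hFG : ∀ i, ∀ y ∈ (e i).target, F ((e i).symm y) = G i y := by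
    intro i y hy
    have hx : (e i).symm y ∈ (e i).source := (e i).map_target hy
    simp only [hF, hD_src i _ hx, hDm, hx, if_true, (e i).right_inv hy, hfe i y hy, hG, hd]
  have hGd : ∀ i y, HasFDerivAt (G i)
      ((0 : 𝔼 m →L[ℝ] ℝ) - fderiv ℝ (lowSq (m := m) (k i)) y + fderiv ℝ (highSq (m := m) (k i)) y -
        (deriv μ (ρf i y)) • (fderiv ℝ (lowSq (m := m) (k i)) y +
          A i • fderiv ℝ (highSq (m := m) (k i)) y)) y := by
    intro i y
    have hl : HasFDerivAt (lowSq (m := m) (k i)) (fderiv ℝ (lowSq (m := m) (k i)) y) y :=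
      (hasFDerivAt_lowSq (k i) y).differentiableAt.hasFDerivAt
    have hh : HasFDerivAt (highSq (m := m) (k i)) (fderiv ℝ (highSq (m := m) (k i)) y) y :=
      (hasFDerivAt_highSq (k i) y).differentiableAt.hasFDerivAt
    have hρ : HasFDerivAt (ρf i) (fderiv ℝ (lowSq (m := m) (k i)) y +
        A i • fderiv ℝ (highSq (m := m) (k i)) y) y :=
      hl.fun_add (hh.const_mul (A i))
    have hμρ : HasFDerivAt (fun y => μ (ρf i y))
        ((deriv μ (ρf i y)) • (fderiv ℝ (lowSq (m := m) (k i)) y +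
          A i • fderiv ℝ (highSq (m := m) (k i)) y)) y :=
      (hμs.differentiable (by simp) _).hasDerivAt.comp_hasFDerivAt y hρ
    exact (((hasFDerivAt_const c y).fun_sub hl).fun_add hh).fun_sub hμρ
  have hGdiff : ∀ i y, DifferentiableAt ℝ (G i) y := fun i y => (hGd i y).differentiableAt
  -- `dGᵢ_y = 0` only at `y = 0`
  have hGcrit : ∀ i y, fderiv ℝ (G i) y = 0 → y = 0 := by
    intro i y hy
    have hμ'y := hμ'ge (ρf i y)
    have hμ'y' := hμ'le (ρf i y)
    have hAi := hApos i
    ext j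
    have hj := DFunLike.congr_fun ((hGd i y).fderiv.symm.trans hy) (EuclideanSpace.single j 1)
    simp only [sub_apply, add_apply, FunLike.coe_smul, Pi.smul_apply, fderiv_lowSq_single,
      fderiv_highSq_single, smul_eq_mul, zero_apply] at hj
    by_cases hjk : j.val < k i
    · simp only [hjk, if_true, not_le.2 hjk, if_false] at hj
      have : (1 + deriv μ (ρf i y)) * y j = 0 := by linarith
      rcases mul_eq_zero.1 this with h | h
      · linarith
      · simpa using h
    · simp only [hjk, if_false, not_lt.1 hjk, if_true] at hj
      have : (1 - A i * deriv μ (ρf i y)) * y j = 0 := by linarith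
      rcases mul_eq_zero.1 this with h | h
      · nlinarith [mul_nonneg hAi.le (neg_nonneg.2 hμ'y')]
      · simpa using h
  -- the values at the centres
  have hF0 : ∀ i, F ((e i).symm 0) = c - μ 0 := by
    intro i
    have h0t : (0 : 𝔼 m) ∈ (e i).target := hRe i (mem_closedBall_self hR.le)
    rw [hFG i 0 h0t]
    simp [hG, hρf, lowSq, highSq]
  have h0Kc : ∀ i, (e i).symm 0 ∈ Kc i := fun i => ⟨0, by simp [Real.sqrt_nonneg], rfl⟩
  -- levels of the push
  set a : ℝ := c - ε' + δF with ha
  set b : ℝ := c + εu + δF with hb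
  have hab : a ≤ b := by rw [ha, hb]; linarith
  have hμ0big : ε' + 2 * δF < μ 0 := by rw [hL] at hμ0ge; linarith
  -- no critical points of `F` in the slab
  have hreg : ∀ x, F x ∈ Icc (a - 2 * δF) (b + 2 * δF) → ¬ IsMCriticalPt (𝓡 m) F x := by
    intro x hx hcr
    by_cases hxK : x ∈ Kall
    · obtain ⟨i, hxi⟩ := mem_iUnion.1 hxK
      have hxs : x ∈ (e i).source := hKc_src i hxi
      have h1 := (isMCriticalPt_iff_fderiv_eq_zero (he i) hxs (hFG i) (hGdiff i _)).1 hcr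
      have hx0 : e i x = 0 := hGcrit i _ h1
      have hxp : x = (e i).symm 0 := by rw [← hx0, (e i).left_inv hxs]
      rw [hxp, hF0 i] at hx
      have := hx.1
      rw [ha] at this
      linarith
    · have hcr' : IsMCriticalPt (𝓡 m) f x :=
        (congrArg (· = 0) (hF_ev x hxK).mfderiv_eq).to_iff.1 hcr
      have hfx : f x ∈ Icc (c - ε' - θ) (c + εu + θ) := by
        rw [← hF_eq x hxK]
        exact ⟨by rw [ha] at hx; linarith [hx.1], by rw [hb] at hx; linarith [hx.2]⟩
      obtain ⟨i, hxp⟩ := hcrit x hfx hcr'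
      exact hxK (mem_iUnion.2 ⟨i, hxp ▸ h0Kc i⟩)
  -- the slab of `F` is compact
  have hcptF : IsCompact (F ⁻¹' Icc (a - 2 * δF) (b + 2 * δF)) := by
    have hsub : F ⁻¹' Icc (a - 2 * δF) (b + 2 * δF) ⊆ f ⁻¹' Icc (c - ε' - θ) (c + εu + θ) ∪ Kall := by
      intro x hx
      by_cases hxK : x ∈ Kall
      · exact Or.inr hxK
      · refine Or.inl ⟨?_, ?_⟩
        · rw [← hF_eq x hxK]; rw [ha] at hx; linarith [hx.1]
        · rw [← hF_eq x hxK]; rw [hb] at hx; linarith [hx.2]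
    exact (hcpt.union hKall_cpt).of_isClosed_subset (isClosed_Icc.preimage hFs.continuous) hsub
  -- KEY: the whole modification region lies in `V`
  have hKcV : ∀ i, ∀ x ∈ (e i).source, ρf i (e i x) < L → x ∈ V := by
    intro i x hxs hlt
    set y := e i x with hy
    have hyt : y ∈ (e i).target := (e i).map_source hxs
    have hxy : x = (e i).symm y := ((e i).left_inv hxs).symm
    have hAi := hApos i
    have hhigh : highSq (k i) y < L / A i := by
      rw [lt_div_iff₀ hAi]
      have := lowSq_nonneg (k i) y
      simp only [hρf] at hlt
      nlinarith
    rcases le_or_gt (lowSq (k i) y) ε' with hlow | hlow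
    · -- close to the descending disc
      have hy₀ : lowPart (k i) y ∈ T₀ i :=
        ⟨highSq_lowPart (k i) y, by rw [lowSq_lowPart]; exact hlow⟩
      have hdist : dist y (lowPart (k i) y) < s₁ i := by
        rw [dist_eq_norm]
        have h1 : ‖y - lowPart (k i) y‖ ^ 2 < s₁ i ^ 2 := by
          have hs₁sq : 0 < s₁ i ^ 2 := by have := hs₁ i; positivity
          have := hLA₁ i
          rw [norm_sub_lowPart_sq]; linarith
        exact lt_of_pow_lt_pow_left₀ 2 (hs₁ i).le h1
      have hyO : y ∈ O i := hthick i (mem_thickening_iff.2 ⟨lowPart (k i) y, hy₀, hdist⟩)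
      rw [hxy]
      exact hyO.2
    · -- strictly below the level `c - ε' + s₀`
      have hfx : f x < c - ε' + s₀ := by
        rw [hxy, hfe i y hyt]
        have := highSq_nonneg (k i) y
        have := hLA₀ i
        linarith
      exact hVs₀ x hfx
  have hFV : ∀ z, F z ≤ c - ε' → z ∈ V := by
    intro z hz
    by_cases h : ∃ i, z ∈ (e i).source ∧ ρf i (e i z) < L
    · obtain ⟨i, hzs, hlt⟩ := h
      exact hKcV i z hzs hlt
    · have hDz : D z = 0 := by
        simp only [hD]
        refine Finset.sum_eq_zero fun i _ => ?_
        simp only [hDm]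
        split_ifs with hzs
        · have : ¬ ρf i (e i z) < L := fun h' => h ⟨i, hzs, h'⟩
          exact hd_zero i _ (not_lt.1 this)
        · rfl
      have : f z ≤ c - ε' := by simp only [hF, hDz, sub_zero] at hz; exact hz
      exact hV₁ z this
  -- push `{F ≤ b}` down to `{F ≤ c - ε'}` along `F`
  obtain ⟨Φ₁, -, hΘdown, hΘfix, -⟩ := exists_diffeomorph_pushDown hFs hab hδF hcptF hreg
  refine ⟨fun q => Φ₁ q.2, fun _ => 1, {x | F x < b}, ?_⟩
  exact
    { contMDiff := Φ₁.contMDiff.comp contMDiff_snd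
      isInvertible := fun s _ x =>
        ⟨Φ₁.mfderivToContinuousLinearEquiv (by simp) x, Φ₁.mfderivToContinuousLinearEquiv_coe _⟩
      contMDiff_cutoff := contMDiff_const
      cutoff_mem := fun _ => ⟨zero_le_one, le_rfl⟩
      isOpen := isOpen_lt hFs.continuous continuous_const
      subset := fun x hx => by
        show F x < b
        have := hFle x; have := hK' x hx; rw [hb]; linarith
      cutoff_eq_one := fun _ _ => rfl
      maps_into := fun x hx => by
        refine hFV _ ?_
        have := hΘdown x (le_of_lt hx)
        rw [ha] at this; linarith
      fixes := fun x hx s => by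
        refine hΘfix x ?_
        have := hFle x; have := hK x hx; rw [ha]; linarith }

end Critical

end Literature.Topology.Immersions
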